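import Mathlib.NumberTheory.NumberField.House
import Mathlib.Analysis.Complex.Liouville
import Mathlib.Analysis.Calculus.MeanValue
import Literature.NumberTheory.Transcendental.LaurentInterpolationDeterminant
import Literature.NumberTheory.Transcendental.TwoLogarithmsZeroLemma
import HarnessLib

/-!
# An explicit lower bound for linear forms in two logarithms: the core estimate

Topic `Literature/NumberTheory/Transcendental`. The interpolation-determinant method of
M. Laurent (1994) and Laurent–Mignotte–Nesterenko (1995) for
`Λ = b₁ log α₁ - b₂ log α₂` (`b₁, b₂ ≥ 1` integers, `α₁, α₂` algebraic), in a crude but fully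
explicit and fully proved form, with free parameters `K, L, R, S, E`:

* the `KL × KL` determinant `Δ = det (x_i^k y_i^l)`, `x_i = r_i b₂ + s_i b₁`, `y_i = α₁^{r_i} α₂^{s_i}`,
  on `KL` points of the grid `r < 2R-1`, `s < 2S-1` is non-zero by the zero lemma
  (`TwoLog.exists_det_ne_zero`, from Philippon's zero estimate on `𝔾ₐ × 𝔾ₘ`);
* (arithmetic) `Δ` is an algebraic integer of `F = ℚ(α₁, α₂)` (we assume `α₁, α₂` integral) whose
  conjugates are at most `N! U^N`, `U = X^{K-1} A^{(2R+2S)(L-1)}` (`X = 2(Rb₂ + Sb₁)`, `A` a bound for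
  the conjugates of the `αᵢ`), so Liouville's inequality gives `|Δ| ≥ (N! U^N)^{-(D-1)}`,
  `D = [F : ℚ]` (`TwoLog.liouville`);
* (analytic) with `θ = log α₁ / b₂`, `λ = Λ/b₂` one has `r log α₁ + s log α₂ = θ x_{r,s} - s λ`, so
  `Δ = Φ(λ)` for the entire function `Φ(w) = det (x_i^k e^{lθx_i} e^{-l s_i w})`; `Φ(0)` is an
  interpolation determinant of the `KL` functions `z^k e^{lθz}` at the points `x_i`, bounded by
  Laurent's lemma (`norm_det_interpolation_le`) by `N! V₁^N E^{-N(N-1)/2}`, and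
  `|Φ(λ) - Φ(0)| ≤ |λ| N! V₂^N` for `|λ| ≤ 1` (Cauchy's inequality and the mean value inequality);
* hence (`TwoLog.lower_bound_core`): if `2 · N! V₁^N · (N! U^N)^{D-1} ≤ E^{N(N-1)/2}` then
  `|Λ| ≥ (N! U^N)^{-(D-1)} / (2 N! V₂^N)`.

The choice of parameters (making the main condition hold with `log E = 1`, `L ≍ log B`,
`R = S ≍ log B`, `K ≍ log B`) is made in the sequel; here everything is parametric. Compared with
LMN 1995 (Théorème 1: `log |Λ| ≥ -C D⁴ h(α₁)h(α₂) (log b')²`) all refinements (binomial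
interpolation, exact asymptotics, optimal radii) are dropped. Everything here is proved; no named
facts.

## References

* M. Laurent, M. Mignotte, Yu. Nesterenko, *Formes linéaires en deux logarithmes et déterminants
  d'interpolation*, J. Number Theory 55 (1995), 285–321 (method; not held).
* A. Baker, G. Wüstholz, *Logarithmic Forms and Diophantine Geometry*, CUP 2007, §2.8 p. 35
  (Laurent's variant "based on interpolation determinants"). [BakerWustholz2007]
* P. Philippon, Bull. Soc. Math. France 114 (1986), Thm. 2.1 (zero estimate). [Philippon1986]
-/

noncomputable section

open Complex Finset NumberField

namespace Literature.NumberTheory.Transcendental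

namespace TwoLog

/-! ### Liouville's inequality -/

/-- **Liouville's inequality** for a non-zero algebraic integer `x` of a number field `F` with an
embedding `φ : F → ℂ`: if all conjugates of `x` are bounded by `B ≥ 1` then
`|φ(x)| ≥ B^{-(D-1)}`, `D = [F : ℚ]` (the norm of `x` is a non-zero rational integer). [folklore] -/
theorem liouville {F : Type*} [Field F] [NumberField F] (φ : F →+* ℂ) {x : 𝓞 F} (hx : x ≠ 0)
    {B : ℝ} (hB : 1 ≤ B) (hc : ∀ σ : F →+* ℂ, ‖σ (x : F)‖ ≤ B) :
    (B ^ (Module.finrank ℚ F - 1))⁻¹ ≤ ‖φ (x : F)‖ := by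
  have h0 := NumberField.norm_norm_le_norm_mul_house_pow (x : F) φ
  have h1 : (1 : ℝ) ≤ ‖Algebra.norm ℚ (x : F)‖ := by
    rw [← Algebra.coe_norm_int]
    have hn : Algebra.norm ℤ x ≠ 0 := Algebra.norm_ne_zero_iff.mpr hx
    rw [Int.norm_cast_rat, Int.norm_eq_abs]
    exact_mod_cast Int.one_le_abs hn
  have hh : house (x : F) ≤ B := by
    rw [house, pi_norm_le_iff_of_nonneg (zero_le_one.trans hB)]
    intro σ; exact hc σ
  have hBpos : 0 < B ^ (Module.finrank ℚ F - 1) := pow_pos (lt_of_lt_of_le zero_lt_one hB) _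
  have h2 : house (x : F) ^ (Module.finrank ℚ F - 1) ≤ B ^ (Module.finrank ℚ F - 1) :=
    pow_le_pow_left₀ (house_nonneg _) hh _
  rw [inv_le_iff_one_le_mul₀ hBpos]
  calc (1 : ℝ) ≤ ‖φ (x : F)‖ * house (x : F) ^ (Module.finrank ℚ F - 1) := h1.trans h0
    _ ≤ ‖φ (x : F)‖ * B ^ (Module.finrank ℚ F - 1) := mul_le_mul_of_nonneg_left h2 (norm_nonneg _)

/-! ### A perturbation estimate for entire functions -/

/-- If `Φ` is entire and `|Φ| ≤ M` on `|w| ≤ 2`, then `|Φ(λ) - Φ(0)| ≤ M |λ|` for `|λ| ≤ 1`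
(Cauchy's inequality on circles of radius `1` and the mean value inequality). [folklore] -/
theorem norm_sub_apply_zero_le {Φ : ℂ → ℂ} (hΦ : Differentiable ℂ Φ) {M : ℝ}
    (hM : ∀ w : ℂ, ‖w‖ ≤ 2 → ‖Φ w‖ ≤ M) {lam : ℂ} (hlam : ‖lam‖ ≤ 1) :
    ‖Φ lam - Φ 0‖ ≤ M * ‖lam‖ := by
  have hderiv : ∀ w ∈ Metric.closedBall (0 : ℂ) 1, ‖deriv Φ w‖ ≤ M := by
    intro w hw
    rw [Metric.mem_closedBall, dist_zero_right] at hw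
    have := Complex.norm_deriv_le_of_forall_mem_sphere_norm_le (f := Φ) (c := w) (R := 1)
      one_pos hΦ.diffContOnCl (fun z hz => hM z ?_)
    · simpa using this
    · rw [Metric.mem_sphere] at hz
      calc ‖z‖ = ‖(z - w) + w‖ := by ring_nf
        _ ≤ ‖z - w‖ + ‖w‖ := norm_add_le _ _
        _ ≤ 2 := by rw [← dist_eq_norm, hz]; linarith
  have := Convex.norm_image_sub_le_of_norm_deriv_le (f := Φ) (fun x _ => hΦ.differentiableAt)
    hderiv (convex_closedBall (0 : ℂ) 1) (Metric.mem_closedBall_self zero_le_one)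
    (by rwa [Metric.mem_closedBall, dist_zero_right])
  simpa using this

/-! ### The parameters and the standing bounds -/

/-- `X = 2(R b₂ + S b₁)`, a bound for the abscissae on the big grid. [folklore] -/
def bigX (b₁ b₂ R S : ℕ) : ℝ := 2 * (R * b₂ + S * b₁)

/-- `U = X^{K-1} A^{(2R+2S)(L-1)}`, a bound for the conjugates of the entries of `Δ`. [folklore] -/
def bndU (A X : ℝ) (K L R S : ℕ) : ℝ := X ^ (K - 1) * A ^ ((2 * R + 2 * S) * (L - 1))

/-- `V₁ = (EX)^{K-1} e^{(L-1) t E X}`, a bound for `|z^k e^{lθz}|` on `|z| ≤ EX` (`t ≥ |θ|`).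
[folklore] -/
def bndV₁ (t X E : ℝ) (K L : ℕ) : ℝ := (E * X) ^ (K - 1) * Real.exp ((L - 1) * (t * (E * X)))

/-- `V₂ = X^{K-1} e^{(L-1)(tX + 4S)}`, a bound for the entries of `Φ(w)`, `|w| ≤ 2`. [folklore] -/
def bndV₂ (t X : ℝ) (K L S : ℕ) : ℝ := X ^ (K - 1) * Real.exp ((L - 1) * (t * X + 4 * S))

/-! ### The core estimate -/

section Core

variable {F : Type*} [Field F] [NumberField F] (φ : F →+* ℂ) (a₁ a₂ : 𝓞 F)
variable {A : ℝ} {l₁ l₂ : ℂ} {b₁ b₂ K L R S : ℕ} {E : ℝ}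

/-- `‖e^{z}‖ ≤ e^{c}` when `‖z‖ ≤ c`. [folklore] -/
theorem norm_exp_le_of_norm_le {z : ℂ} {c : ℝ} (h : ‖z‖ ≤ c) : ‖cexp z‖ ≤ Real.exp c :=
  (Complex.norm_exp_le_exp_norm z).trans (Real.exp_le_exp.mpr h)

/-- Abscissae on the big grid are at most `X`. [folklore] -/
theorem xc_le_bigX {r s : ℕ} (hr : r < 2 * R - 1) (hs : s < 2 * S - 1) :
    ((xc b₁ b₂ r s : ℕ) : ℝ) ≤ bigX b₁ b₂ R S := by
  unfold xc bigX
  have h1 : (r : ℝ) ≤ 2 * R := by exact_mod_cast (by omega : r ≤ 2 * R)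
  have h2 : (s : ℝ) ≤ 2 * S := by exact_mod_cast (by omega : s ≤ 2 * S)
  push_cast
  nlinarith [Nat.cast_nonneg (α := ℝ) b₁, Nat.cast_nonneg (α := ℝ) b₂]

/-- **The core estimate for two logarithms** (Laurent's method, crude explicit form). Let
`F` be a number field with an embedding `φ`, `a₁, a₂ ∈ 𝓞 F` with all conjugates bounded by
`A ≥ 1`, `e^{l₁} = φ(a₁)`, `e^{l₂} = φ(a₂)`, `b₂ ≥ 1` (and any `b₁ ∈ ℕ`), and parameters `K, L ≥ 2`, `R, S` with
`RS > 2(K-1)(L-1)`, `E ≥ 1`, such that the abscissae `r b₂ + s b₁` and the ordinates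
`e^{r l₁ + s l₂}` (`r < R`, `s < S`) are pairwise distinct. Put `N = KL`, `D = [F:ℚ]`,
`X = 2(Rb₂ + Sb₁)`, `t = |l₁|/b₂`, `U = X^{K-1}A^{(2R+2S)(L-1)}`, `V₁ = (EX)^{K-1}e^{(L-1)tEX}`,
`V₂ = X^{K-1}e^{(L-1)(tX+4S)}`. If `2 · N! V₁^N · (N! U^N)^{D-1} ≤ E^{N(N-1)/2}` then
`|b₁ l₁ - b₂ l₂| ≥ (N! U^N)^{-(D-1)} / (2 · N! V₂^N)`.
[cite: BakerWustholz2007, §2.8 p. 35 (Laurent's interpolation determinants)] -/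
theorem lower_bound_core (hA : 1 ≤ A) (hA₁ : ∀ σ : F →+* ℂ, ‖σ (a₁ : F)‖ ≤ A)
    (hA₂ : ∀ σ : F →+* ℂ, ‖σ (a₂ : F)‖ ≤ A)
    (hl₁ : cexp l₁ = φ a₁) (hl₂ : cexp l₂ = φ a₂) (hb₂ : 0 < b₂)
    (hK : 2 ≤ K) (hL : 2 ≤ L) (hRS : 2 * (K - 1) * (L - 1) < R * S)
    (hx : Set.InjOn (fun p : ℕ × ℕ => xc b₁ b₂ p.1 p.2) ↑(grid R S))
    (hy : Set.InjOn (fun p : ℕ × ℕ => cexp (p.1 * l₁ + p.2 * l₂)) ↑(grid R S))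
    (hE : 1 ≤ E)
    (hmain : 2 * ((K * L).factorial * bndV₁ (‖l₁‖ / b₂) (bigX b₁ b₂ R S) E K L ^ (K * L)) *
      ((K * L).factorial * bndU A (bigX b₁ b₂ R S) K L R S ^ (K * L)) ^ (Module.finrank ℚ F - 1) ≤
        E ^ (K * L * (K * L - 1) / 2)) :
    (((K * L).factorial * bndU A (bigX b₁ b₂ R S) K L R S ^ (K * L)) ^
        (Module.finrank ℚ F - 1))⁻¹ /
        (2 * ((K * L).factorial * bndV₂ (‖l₁‖ / b₂) (bigX b₁ b₂ R S) K L S ^ (K * L))) ≤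
      ‖(b₁ : ℂ) * l₁ - b₂ * l₂‖ := by
  classical
  -- notation
  set X : ℝ := bigX b₁ b₂ R S with hXdef
  set t : ℝ := ‖l₁‖ / b₂ with htdef
  set U : ℝ := bndU A X K L R S with hUdef
  set V₁ : ℝ := bndV₁ t X E K L with hV₁def
  set V₂ : ℝ := bndV₂ t X K L S with hV₂def
  set Λ : ℂ := (b₁ : ℂ) * l₁ - b₂ * l₂ with hΛdef
  set θ : ℂ := l₁ / b₂ with hθdef
  set lam : ℂ := Λ / b₂ with hlamdef
  have hb₂C : (b₂ : ℂ) ≠ 0 := by exact_mod_cast hb₂.ne'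
  have hb₂R : (0 : ℝ) < b₂ := by exact_mod_cast hb₂
  have hRpos : 0 < R := Nat.pos_of_ne_zero fun h => by subst h; simp at hRS
  have hX1 : 1 ≤ X := by
    rw [hXdef, bigX]
    have : (1 : ℝ) ≤ R * b₂ := by exact_mod_cast Nat.mul_pos hRpos hb₂
    nlinarith [Nat.cast_nonneg (α := ℝ) (S * b₁), show ((S * b₁ : ℕ) : ℝ) = S * b₁ by push_cast; ring]
  have hX0 : 0 ≤ X := zero_le_one.trans hX1
  have ht0 : 0 ≤ t := div_nonneg (norm_nonneg _) hb₂R.le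
  have hθt : ‖θ‖ = t := by rw [hθdef, norm_div, Complex.norm_natCast]
  -- the units `α₁ = e^{l₁}`, `α₂ = e^{l₂}`
  set α₁ : ℂˣ := Units.mk0 (cexp l₁) (Complex.exp_ne_zero _) with hα₁
  set α₂ : ℂˣ := Units.mk0 (cexp l₂) (Complex.exp_ne_zero _) with hα₂
  have hyc : ∀ r s : ℕ, ((yc α₁ α₂ r s : ℂˣ) : ℂ) = cexp (r * l₁ + s * l₂) := by
    intro r s
    rw [yc, Units.val_mul, Units.val_pow_eq_pow_val, Units.val_pow_eq_pow_val, hα₁, hα₂,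
      Units.val_mk0, Units.val_mk0, Complex.exp_add, Complex.exp_nat_mul, Complex.exp_nat_mul]
  have hy' : Set.InjOn (fun p : ℕ × ℕ => yc α₁ α₂ p.1 p.2) ↑(grid R S) := by
    intro p hp p' hp' h
    exact hy hp hp' (by simpa [hyc] using congrArg (fun u : ℂˣ => (u : ℂ)) h)
  -- the non-singular interpolation matrix
  obtain ⟨ρ, hρ, _, hdet⟩ := exists_det_ne_zero (b₁ := b₁) (b₂ := b₂) (α₁ := α₁) (α₂ := α₂)
    hK hL hRS hx hy'
  have hN : Fintype.card (Fin K × Fin L) = K * L := by simp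
  set xi : Fin K × Fin L → ℕ := fun i => xc b₁ b₂ (ρ i).1 (ρ i).2 with hxi
  have hxiX : ∀ i, ((xi i : ℕ) : ℝ) ≤ X := fun i => xc_le_bigX (hρ i).1 (hρ i).2
  set M₀ : Matrix (Fin K × Fin L) (Fin K × Fin L) ℂ := Matrix.of fun i j =>
    (xi i : ℂ) ^ (j.1 : ℕ) * ((yc α₁ α₂ (ρ i).1 (ρ i).2 : ℂˣ) : ℂ) ^ (j.2 : ℕ) with hM₀
  have hdet0 : M₀.det ≠ 0 := hdet
  ---------------------------------------------------------------
  -- ARITHMETIC SIDE: `|det M₀| ≥ (N! U^N)^{-(D-1)}`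
  ---------------------------------------------------------------
  set Mint : Matrix (Fin K × Fin L) (Fin K × Fin L) (𝓞 F) := Matrix.of fun i j =>
    ((xi i : ℕ) : 𝓞 F) ^ (j.1 : ℕ) * (a₁ ^ (ρ i).1 * a₂ ^ (ρ i).2) ^ (j.2 : ℕ) with hMint
  set φ' : 𝓞 F →+* ℂ := φ.comp (algebraMap (𝓞 F) F) with hφ'
  have hφ'a₁ : φ' a₁ = cexp l₁ := by rw [hφ', RingHom.comp_apply, hl₁]
  have hφ'a₂ : φ' a₂ = cexp l₂ := by rw [hφ', RingHom.comp_apply, hl₂]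
  have hmap : φ'.mapMatrix Mint = M₀ := by
    ext i j
    simp only [RingHom.mapMatrix_apply, Matrix.map_apply, hMint, hM₀, Matrix.of_apply, map_mul,
      map_pow, map_natCast, hφ'a₁, hφ'a₂, hyc, Complex.exp_add, Complex.exp_nat_mul]
  have hdetint : φ' Mint.det = M₀.det := by rw [RingHom.map_det, hmap]
  have hMint0 : Mint.det ≠ 0 := fun h => hdet0 (by rw [← hdetint, h, map_zero])
  -- conjugate bounds
  have hU1 : 1 ≤ U := by
    rw [hUdef, bndU]
    exact one_le_mul_of_one_le_of_one_le (one_le_pow₀ hX1) (one_le_pow₀ hA)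
  have hentry : ∀ (σ : F →+* ℂ) (i j : Fin K × Fin L),
      ‖σ (((Mint i j : 𝓞 F) : F))‖ ≤ U := by
    intro σ i j
    have hk : (j.1 : ℕ) ≤ K - 1 := by have := j.1.isLt; omega
    have hl : (j.2 : ℕ) ≤ L - 1 := by have := j.2.isLt; omega
    have hr : (ρ i).1 ≤ 2 * R := by have := (hρ i).1; omega
    have hs : (ρ i).2 ≤ 2 * S := by have := (hρ i).2; omega
    simp only [hMint, Matrix.of_apply]
    push_cast
    rw [map_mul, map_pow, map_pow, map_mul, map_pow, map_pow, map_natCast, norm_mul, norm_pow,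
      norm_pow, norm_mul, norm_pow, norm_pow, Complex.norm_natCast]
    rw [hUdef, bndU]
    have hxX : ((xi i : ℕ) : ℝ) ^ (j.1 : ℕ) ≤ X ^ (K - 1) :=
      (pow_le_pow_left₀ (Nat.cast_nonneg _) (hxiX i) _).trans (pow_le_pow_right₀ hX1 hk)
    have ha : (‖σ (a₁ : F)‖ ^ (ρ i).1 * ‖σ (a₂ : F)‖ ^ (ρ i).2) ^ (j.2 : ℕ) ≤
        A ^ ((2 * R + 2 * S) * (L - 1)) := by
      have h1 : ‖σ (a₁ : F)‖ ^ (ρ i).1 * ‖σ (a₂ : F)‖ ^ (ρ i).2 ≤ A ^ (2 * R + 2 * S) := by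
        calc ‖σ (a₁ : F)‖ ^ (ρ i).1 * ‖σ (a₂ : F)‖ ^ (ρ i).2
            ≤ A ^ (ρ i).1 * A ^ (ρ i).2 :=
              mul_le_mul (pow_le_pow_left₀ (norm_nonneg _) (hA₁ σ) _)
                (pow_le_pow_left₀ (norm_nonneg _) (hA₂ σ) _) (by positivity) (by positivity)
          _ = A ^ ((ρ i).1 + (ρ i).2) := (pow_add _ _ _).symm
          _ ≤ A ^ (2 * R + 2 * S) := pow_le_pow_right₀ hA (by omega)
      calc (‖σ (a₁ : F)‖ ^ (ρ i).1 * ‖σ (a₂ : F)‖ ^ (ρ i).2) ^ (j.2 : ℕ)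
          ≤ (A ^ (2 * R + 2 * S)) ^ (j.2 : ℕ) := pow_le_pow_left₀ (by positivity) h1 _
        _ ≤ (A ^ (2 * R + 2 * S)) ^ (L - 1) := pow_le_pow_right₀ (one_le_pow₀ hA) hl
        _ = A ^ ((2 * R + 2 * S) * (L - 1)) := (pow_mul _ _ _).symm
    exact mul_le_mul hxX ha (by positivity) (by positivity)
  have hconj : ∀ σ : F →+* ℂ, ‖σ ((Mint.det : 𝓞 F) : F)‖ ≤ (K * L).factorial * U ^ (K * L) := by
    intro σ
    have : σ ((Mint.det : 𝓞 F) : F) = ((σ.comp (algebraMap (𝓞 F) F)).mapMatrix Mint).det := by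
      rw [← RingHom.map_det]; rfl
    rw [this]
    have hb := Laurent.norm_det_le_of_col_le ((σ.comp (algebraMap (𝓞 F) F)).mapMatrix Mint)
      (C := fun _ => U) (fun i j => by simpa using hentry σ i j)
    simpa [hN, Finset.prod_const, Finset.card_univ] using hb
  have hNU1 : 1 ≤ ((K * L).factorial : ℝ) * U ^ (K * L) :=
    one_le_mul_of_one_le_of_one_le (by exact_mod_cast Nat.one_le_iff_ne_zero.mpr (Nat.factorial_ne_zero _))
      (one_le_pow₀ hU1)
  have hLiou : ((((K * L).factorial : ℝ) * U ^ (K * L)) ^ (Module.finrank ℚ F - 1))⁻¹ ≤ ‖M₀.det‖ := by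
    have h := liouville φ hMint0 hNU1 hconj
    have e : φ ((Mint.det : 𝓞 F) : F) = M₀.det := hdetint
    rwa [e] at h
  ---------------------------------------------------------------
  -- ANALYTIC SIDE
  ---------------------------------------------------------------
  -- the key identity `r l₁ + s l₂ = θ x_{r,s} - s λ`
  have hkey : ∀ r s : ℕ, (r : ℂ) * l₁ + s * l₂ = θ * (xc b₁ b₂ r s : ℕ) - s * lam := by
    intro r s
    rw [hθdef, hlamdef, hΛdef, xc]
    push_cast
    field_simp
    ring
  -- the entire function `Φ`
  set Aent : (Fin K × Fin L) → (Fin K × Fin L) → ℂ → ℂ := fun i j w =>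
    (xi i : ℂ) ^ (j.1 : ℕ) * cexp ((j.2 : ℕ) * (θ * (xi i : ℕ))) *
      cexp (-((j.2 : ℕ) * ((ρ i).2 * w))) with hAent
  set Φ : ℂ → ℂ := fun w => Matrix.det (Matrix.of fun i j => Aent i j w) with hΦdef
  have hAdiff : ∀ i j, Differentiable ℂ (Aent i j) := by
    intro i j
    simp only [hAent]
    fun_prop
  have hΦdiff : Differentiable ℂ Φ := fun w =>
    (Laurent.hasDerivAt_det (A := Aent) (A' := fun i j => deriv (Aent i j))
      (fun i j => ((hAdiff i j) w).hasDerivAt)).differentiableAt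
  -- `Φ(λ) = det M₀`
  have hΦlam : Φ lam = M₀.det := by
    simp only [hΦdef, hM₀]
    congr 1
    ext i j
    simp only [Matrix.of_apply, hAent, hyc]
    rw [mul_assoc, ← Complex.exp_add, hkey, ← Complex.exp_nat_mul]
    congr 2
    ring
  -- `Φ(0)` is an interpolation determinant: Laurent's lemma
  set f : (Fin K × Fin L) → ℂ → ℂ := fun j z => z ^ (j.1 : ℕ) * cexp ((j.2 : ℕ) * (θ * z)) with hfdef
  have hfdiff : ∀ j, Differentiable ℂ (f j) := by intro j; simp only [hfdef]; fun_prop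
  have hΦ0 : Φ 0 = Matrix.det (Matrix.of fun i j => f j (xi i : ℕ)) := by
    simp only [hΦdef, hAent, hfdef]
    congr 1
    ext i j
    simp
  have hEX1 : 1 ≤ E * X := one_le_mul_of_one_le_of_one_le hE hX1
  have hV₁0 : 0 ≤ V₁ := by rw [hV₁def, bndV₁]; positivity
  have hfC : ∀ (j : Fin K × Fin L) (z : ℂ), ‖z‖ ≤ E * X → ‖f j z‖ ≤ V₁ := by
    intro j z hz
    have hk : (j.1 : ℕ) ≤ K - 1 := by have := j.1.isLt; omega
    have hl : ((j.2 : ℕ) : ℝ) ≤ L - 1 := by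
      have h1 : ((j.2 : ℕ) : ℝ) + 1 ≤ (L : ℝ) := by exact_mod_cast Nat.succ_le_of_lt j.2.isLt
      linarith
    simp only [hfdef, norm_mul, norm_pow]
    rw [hV₁def, bndV₁]
    refine mul_le_mul ((pow_le_pow_left₀ (norm_nonneg _) hz _).trans (pow_le_pow_right₀ hEX1 hk))
      (norm_exp_le_of_norm_le ?_) (norm_nonneg _) (pow_nonneg (zero_le_one.trans hEX1) _)
    rw [norm_mul, norm_mul, Complex.norm_natCast, hθt]
    calc ((j.2 : ℕ) : ℝ) * (t * ‖z‖) ≤ (L - 1) * (t * (E * X)) :=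
          mul_le_mul hl (mul_le_mul_of_nonneg_left hz ht0) (by positivity) (by linarith)
      _ = (L - 1) * (t * (E * X)) := rfl
  have hLaurent : ‖Φ 0‖ ≤ (K * L).factorial * V₁ ^ (K * L) / E ^ (K * L * (K * L - 1) / 2) := by
    rw [hΦ0]
    have := norm_det_interpolation_le (ι := Fin K × Fin L) hfdiff (ζ := fun i => ((xi i : ℕ) : ℂ)) (r := X)
      hE (fun i => by rw [Complex.norm_natCast]; exact hxiX i) (C := fun _ => V₁) hfC
    simpa [hN, Finset.prod_const, Finset.card_univ] using this
  -- `|Φ(w)| ≤ N! V₂^N` for `|w| ≤ 2`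
  have hL1 : (0 : ℝ) ≤ (L : ℝ) - 1 := by
    have : (2 : ℝ) ≤ L := by exact_mod_cast hL
    linarith
  have hV₂1 : 1 ≤ V₂ := by
    rw [hV₂def, bndV₂]
    exact one_le_mul_of_one_le_of_one_le (one_le_pow₀ hX1)
      (Real.one_le_exp (mul_nonneg hL1 (add_nonneg (mul_nonneg ht0 hX0) (by positivity))))
  have hΦbd : ∀ w : ℂ, ‖w‖ ≤ 2 → ‖Φ w‖ ≤ (K * L).factorial * V₂ ^ (K * L) := by
    intro w hw
    simp only [hΦdef]
    have hb := Laurent.norm_det_le_of_col_le (Matrix.of fun i j => Aent i j w) (C := fun _ => V₂)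
      (fun i j => ?_)
    · simpa [hN, Finset.prod_const, Finset.card_univ] using hb
    · have hk : (j.1 : ℕ) ≤ K - 1 := by have := j.1.isLt; omega
      have hl : ((j.2 : ℕ) : ℝ) ≤ L - 1 := by
        have h1 : ((j.2 : ℕ) : ℝ) + 1 ≤ (L : ℝ) := by exact_mod_cast Nat.succ_le_of_lt j.2.isLt
        linarith
      have hs : (((ρ i).2 : ℕ) : ℝ) ≤ 2 * S := by exact_mod_cast (by have := (hρ i).2; omega : (ρ i).2 ≤ 2 * S)
      simp only [Matrix.of_apply, hAent, norm_mul, norm_pow, Complex.norm_natCast]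
      rw [hV₂def, bndV₂, mul_add, Real.exp_add]
      refine le_trans ?_ (le_of_eq (mul_assoc _ _ _))
      refine mul_le_mul (mul_le_mul ((pow_le_pow_left₀ (Nat.cast_nonneg _) (hxiX i) _).trans
        (pow_le_pow_right₀ hX1 hk)) (norm_exp_le_of_norm_le ?_) (norm_nonneg _) (by positivity))
        (norm_exp_le_of_norm_le ?_) (norm_nonneg _) (by positivity)
      · rw [norm_mul, norm_mul, Complex.norm_natCast, Complex.norm_natCast, hθt]
        exact mul_le_mul hl (mul_le_mul_of_nonneg_left (hxiX i) ht0) (by positivity) (by linarith)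
      · rw [norm_neg, norm_mul, norm_mul, Complex.norm_natCast, Complex.norm_natCast]
        calc ((j.2 : ℕ) : ℝ) * (((ρ i).2 : ℝ) * ‖w‖) ≤ (L - 1) * (2 * S * 2) :=
              mul_le_mul hl (mul_le_mul hs hw (norm_nonneg _) (by positivity)) (by positivity)
                (by linarith)
          _ = (L - 1) * (4 * S) := by ring
  ---------------------------------------------------------------
  -- COMBINATION
  ---------------------------------------------------------------
  set Li : ℝ := ((((K * L).factorial : ℝ) * U ^ (K * L)) ^ (Module.finrank ℚ F - 1))⁻¹ with hLidef
  set M₂ : ℝ := ((K * L).factorial : ℝ) * V₂ ^ (K * L) with hM₂def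
  have hLipos : 0 < Li := by rw [hLidef]; positivity
  have hLi1 : Li ≤ 1 := by rw [hLidef]; exact inv_le_one_of_one_le₀ (one_le_pow₀ hNU1)
  have hM₂1 : 1 ≤ M₂ := one_le_mul_of_one_le_of_one_le
    (by exact_mod_cast Nat.one_le_iff_ne_zero.mpr (Nat.factorial_ne_zero _)) (one_le_pow₀ hV₂1)
  have hM₂pos : 0 < M₂ := by linarith
  have hgoal : Li / (2 * M₂) ≤ ‖Λ‖ := by
    have hΛlam : ‖Λ‖ = b₂ * ‖lam‖ := by
      rw [hlamdef, norm_div, Complex.norm_natCast]; field_simp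
    have hlamΛ : ‖lam‖ ≤ ‖Λ‖ := by
      rw [hΛlam]
      have : (1 : ℝ) ≤ b₂ := by exact_mod_cast hb₂
      nlinarith [norm_nonneg lam]
    by_cases hlam1 : ‖lam‖ ≤ 1
    · -- the main case
      have hE0 : 0 < E := by linarith
      have hP₀ : ((K * L).factorial : ℝ) * V₁ ^ (K * L) / E ^ (K * L * (K * L - 1) / 2) ≤ Li / 2 := by
        have hET : 0 < E ^ (K * L * (K * L - 1) / 2) := pow_pos hE0 _
        have hQpos : 0 < (((K * L).factorial : ℝ) * U ^ (K * L)) ^ (Module.finrank ℚ F - 1) := by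
          positivity
        rw [div_le_iff₀ hET]
        have e : Li / 2 * E ^ (K * L * (K * L - 1) / 2) =
            E ^ (K * L * (K * L - 1) / 2) / (2 * (((K * L).factorial : ℝ) * U ^ (K * L)) ^
              (Module.finrank ℚ F - 1)) := by
          rw [hLidef]; field_simp
        rw [e, le_div_iff₀ (by positivity)]
        calc ((K * L).factorial : ℝ) * V₁ ^ (K * L) *
              (2 * ((((K * L).factorial : ℝ) * U ^ (K * L)) ^ (Module.finrank ℚ F - 1)))
            = 2 * (((K * L).factorial : ℝ) * V₁ ^ (K * L)) *
                ((((K * L).factorial : ℝ) * U ^ (K * L)) ^ (Module.finrank ℚ F - 1)) := by ring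
          _ ≤ E ^ (K * L * (K * L - 1) / 2) := hmain
      have h1 : Li ≤ ‖Φ 0‖ + ‖Φ lam - Φ 0‖ := by
        calc Li ≤ ‖M₀.det‖ := hLiou
          _ = ‖Φ lam‖ := by rw [hΦlam]
          _ = ‖Φ 0 + (Φ lam - Φ 0)‖ := by ring_nf
          _ ≤ ‖Φ 0‖ + ‖Φ lam - Φ 0‖ := norm_add_le _ _
      have h2 : ‖Φ lam - Φ 0‖ ≤ M₂ * ‖lam‖ := norm_sub_apply_zero_le hΦdiff hΦbd hlam1
      have h3 : Li / 2 ≤ M₂ * ‖lam‖ := by linarith [hLaurent]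
      calc Li / (2 * M₂) = (Li / 2) / M₂ := by rw [div_div]
        _ ≤ (M₂ * ‖lam‖) / M₂ := div_le_div_of_nonneg_right h3 hM₂pos.le
        _ = ‖lam‖ := by field_simp
        _ ≤ ‖Λ‖ := hlamΛ
    · push Not at hlam1
      calc Li / (2 * M₂) ≤ 1 / (2 * 1) := by
            exact div_le_div₀ zero_le_one hLi1 (by norm_num) (by linarith)
        _ ≤ 1 := by norm_num
        _ ≤ ‖Λ‖ := (hlam1.le.trans hlamΛ)
  exact hgoal

end Core

end TwoLog

end Literature.NumberTheory.Transcendental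

end
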